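import Literature.NumberTheory.PAdicHodge.AinfRamifiedWitt
import Literature.NumberTheory.PAdicHodge.AinfRamifiedKernel
import HarnessLib

/-!
# `A_inf(𝒪_F) = 𝔸_inf(F)[X]/(E)` for a general `p`-adic field: the tilt `π♭`, the degree-one primitive element
# `ω = ϖ − [π♭]`, and `ker θ_𝒪 = ω · A_inf(𝒪_F)`

Topic `Literature/NumberTheory/PAdicHodge`; sequel of `AinfRamifiedWitt` (`A_inf(𝒪_F)`, `θ_𝒪` for an Eisenstein datum
`D = (E, π)` over `W(k_F)`) and `AinfRamifiedKernel` (the `ℤ_p`-coefficient case, whose §1 — `𝒪_{ℂ_F}♭` is a valuation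
ring for `‖·♯‖`, units of `𝔸_inf` are detected mod `p` — is generic and reused here), `FontaineThetaKernel`
(`p♭`, `ξ`, `ker θ = ξ 𝔸_inf`).

This is the residue-degree-`f` version of `AinfRamifiedKernel` §2–§4, for `D : EisensteinRootW F p hp`:

* §2 **the tilt `π♭ = (π^{1/pⁿ} mod p)ₙ ∈ 𝒪_{ℂ_F}♭`** of the root (`unifFlat`; compatible roots `unifSeq` taken in
  `F̄`), `(π♭)♯ = π`, `θ([π♭]) = π`, and **`(π♭)^e = p♭ · unit`** (both untilt to absolute value `‖p‖`).
* §3 **`ω = ϖ − [π♭] ∈ ker θ_𝒪`** and **`E([π♭]) = ξ · unit` in `𝔸_inf(F)`** (`θ(E([π♭])) = E(π) = 0`; modulo `p`,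
  `E ≡ X^e` since `E` is Eisenstein over `W(k_F)` and `W(k_F) → 𝔸_inf` sends `p ↦ p`).
* §4 **`ker θ_𝒪 = ω · A_inf(𝒪_F)`** (`ker_theta_eq_span_omega`), `θ_𝒪 x = 0 ↔ ω ∣ x`, `ω ∣ ξ`, `ω ∣ σ(ω)`.

Definitions (reviewed): `EisensteinRootW.unifSeq`, `.unifSeqC`, `.unifFlat`, `AinfRamW.omega`.  No named facts,
no instances, no `sorry`.

## References
* [FarguesFontaine2018] L. Fargues, J.-M. Fontaine, Astérisque 406 (2018), §1.2 (`W_{𝒪_E}`), §2.2 (primitive elements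
  of degree one, Déf. 2.2.1; Cor. 2.2.8).
* [FontaineAsterisque223III] J.-M. Fontaine, Astérisque 223 (1994), Exp. II §1.2.2 (`ker θ = (ξ)`, generators of `ker θ`).
* [FontaineOuyang2022] J.-M. Fontaine, Y. Ouyang, *Theory of p-adic Galois representations*, Prop. 4.3.3, Prop. 4.4.3.
* [SerreLocalFields1979] J.-P. Serre, *Local Fields*, Ch. I §6 Prop. 17 (Eisenstein polynomials).
-/

noncomputable section

open ValuativeRel Field Ideal WittVector Polynomial

namespace Literature.NumberTheory.PAdicHodge

open Literature.NumberTheory.GaloisRepresentations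
open Literature.NumberTheory.GaloisRepresentations.IsNonarchimedeanLocalField

variable {F : Type} [Field F] [ValuativeRel F] [TopologicalSpace F] [IsNonarchimedeanLocalField F]
  {p : ℕ} [Fact p.Prime]

/-! ## §2 The tilt `ϖ♭` of the root -/

namespace EisensteinRootW

variable [CharZero F] {hp : valuation F p < 1}

/-- **A compatible system of `pⁿ`-th roots of `ϖ` in `F̄`**: `ϖ₀ = ϖ`, `ϖₙ₊₁^p = ϖₙ` (roots exist since `F̄` is
algebraically closed). [cite: FontaineOuyang2022, §4.3] -/
def unifSeq (D : EisensteinRootW F p hp) : ℕ → NormedAlgClosure F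
  | 0 => algebraMap F (NormedAlgClosure F) D.unif
  | n + 1 => Classical.choose (IsAlgClosed.exists_pow_nat_eq (unifSeq D n) (Fact.out : p.Prime).pos)

variable (D : EisensteinRootW F p hp)

/-- `ϖₙ₊₁^p = ϖₙ`. [cite: FontaineOuyang2022, §4.3] -/
theorem unifSeq_succ_pow (n : ℕ) : D.unifSeq (n + 1) ^ p = D.unifSeq n :=
  Classical.choose_spec (IsAlgClosed.exists_pow_nat_eq (D.unifSeq n) (Fact.out : p.Prime).pos)

/-- `ϖₙ ^ pⁿ = ϖ`. [cite: FontaineOuyang2022, §4.3] -/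
theorem unifSeq_pow (n : ℕ) : D.unifSeq n ^ p ^ n = algebraMap F (NormedAlgClosure F) D.unif := by
  induction n with
  | zero => rw [pow_zero, pow_one]; rfl
  | succ n ih => rw [pow_succ', pow_mul, unifSeq_succ_pow, ih]

/-- `ϖₙ ^ pⁿ = ϖ` in `ℂ_F`. [cite: FontaineOuyang2022, §4.3] -/
theorem coe_unifSeq_pow (n : ℕ) :
    ((D.unifSeq n : NormedAlgClosure F) : CompletedAlgClosure F) ^ p ^ n = algebraMap F (CompletedAlgClosure F) D.unif := by
  change (UniformSpace.Completion.coeRingHom : NormedAlgClosure F →+* CompletedAlgClosure F) (D.unifSeq n) ^ p ^ n = _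
  rw [← map_pow, unifSeq_pow, CompletedAlgClosure.algebraMap_eq_coe]; rfl

/-- `‖ϖₙ‖ ^ pⁿ = ‖ϖ‖` in `ℂ_F`. [cite: FontaineOuyang2022, §4.3] -/
theorem norm_coe_unifSeq_pow (n : ℕ) :
    ‖((D.unifSeq n : NormedAlgClosure F) : CompletedAlgClosure F)‖ ^ p ^ n = ‖algebraMap F (CompletedAlgClosure F) D.unif‖ := by
  rw [← norm_pow, coe_unifSeq_pow]

/-- `‖ϖₙ‖ ≤ 1`. [cite: FontaineOuyang2022, §4.3] -/
theorem norm_coe_unifSeq_le_one (n : ℕ) : ‖((D.unifSeq n : NormedAlgClosure F) : CompletedAlgClosure F)‖ ≤ 1 := by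
  by_contra hlt
  have h1 : 1 < ‖((D.unifSeq n : NormedAlgClosure F) : CompletedAlgClosure F)‖ ^ p ^ n :=
    one_lt_pow₀ (not_le.1 hlt) (pow_ne_zero _ (Fact.out : p.Prime).ne_zero)
  rw [norm_coe_unifSeq_pow] at h1
  exact absurd D.norm_algebraMap_unif_le_one (not_le.2 h1)

/-- **`ϖ^{1/pⁿ} ∈ 𝒪_{ℂ_F}`.** [cite: FontaineOuyang2022, §4.3] -/
def unifSeqC (n : ℕ) : integerC F :=
  ⟨((D.unifSeq n : NormedAlgClosure F) : CompletedAlgClosure F), (mem_integerC_iff).2 (D.norm_coe_unifSeq_le_one n)⟩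

/-- Unfolding `unifSeqC`. [cite: FontaineOuyang2022, §4.3] -/
theorem coe_unifSeqC (n : ℕ) :
    ((D.unifSeqC n : integerC F) : CompletedAlgClosure F) = ((D.unifSeq n : NormedAlgClosure F) : CompletedAlgClosure F) := rfl

/-- `ϖₙ₊₁^p = ϖₙ` in `𝒪_{ℂ_F}`. [cite: FontaineOuyang2022, §4.3] -/
theorem unifSeqC_succ_pow (n : ℕ) : D.unifSeqC (n + 1) ^ p = D.unifSeqC n := by
  refine Subtype.ext ?_
  rw [SubmonoidClass.coe_pow, coe_unifSeqC, coe_unifSeqC]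
  change (UniformSpace.Completion.coeRingHom : NormedAlgClosure F →+* CompletedAlgClosure F) (D.unifSeq (n + 1)) ^ p =
    (UniformSpace.Completion.coeRingHom : NormedAlgClosure F →+* CompletedAlgClosure F) (D.unifSeq n)
  rw [← map_pow, unifSeq_succ_pow]

/-- `ϖₙ ^ pⁿ = ϖ` in `𝒪_{ℂ_F}`. [cite: FontaineOuyang2022, §4.3] -/
theorem unifSeqC_pow (n : ℕ) : D.unifSeqC n ^ p ^ n = D.unifC := by
  refine Subtype.ext ?_
  rw [SubmonoidClass.coe_pow, coe_unifSeqC, coe_unifSeq_pow, coe_unifC]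

variable [Fact (¬ IsUnit (p : integerC F))]

/-- **The tilt `ϖ♭ = (ϖ^{1/pⁿ} mod p)ₙ ∈ 𝒪_{ℂ_F}♭` of the root.** [cite: FarguesFontaine2018, §2.2] [cite: FontaineOuyang2022, §4.3] -/
def unifFlat : PreTilt (integerC F) p :=
  ⟨fun n => Ideal.Quotient.mk _ (D.unifSeqC n), fun n => by rw [← map_pow, unifSeqC_succ_pow]⟩

/-- Coefficients of `ϖ♭`. [cite: FontaineOuyang2022, §4.3] -/
@[simp] theorem coeff_unifFlat (n : ℕ) : PreTilt.coeff n D.unifFlat = Ideal.Quotient.mk _ (D.unifSeqC n) := rfl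

variable [IsAdicComplete (Ideal.span {(p : integerC F)}) (integerC F)]

/-- **`(ϖ♭)♯ = ϖ`.** [cite: FarguesFontaine2018, §2.2] [cite: FontaineOuyang2022, §4.3] -/
theorem untilt_unifFlat : PreTilt.untilt D.unifFlat = D.unifC := by
  change Perfection.teichmuller p (Ideal.span {(p : integerC F)}) D.unifFlat = _
  refine Perfection.teichmuller_spec fun n => ⟨D.unifSeqC n, rfl, ?_⟩
  rw [unifSeqC_pow]
  exact SModEq.refl (M := integerC F) _

/-- **`θ([ϖ♭]) = ϖ`.** [cite: FarguesFontaine2018, §2.2] [cite: FontaineAsterisque223III, Exp. II §1.2.2] -/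
theorem fontaineTheta_teichmuller_unifFlat : fontaineTheta (integerC F) p (teichmuller p D.unifFlat) = D.unifC := by
  rw [fontaineTheta_teichmuller, untilt_unifFlat]

/-- `‖((ϖ♭)^e)♯‖ = ‖p‖ = ‖(p♭)♯‖`. [cite: FontaineOuyang2022, §4.3] -/
theorem norm_untilt_unifFlat_pow :
    ‖((PreTilt.untilt (D.unifFlat ^ D.deg) : integerC F) : CompletedAlgClosure F)‖ =
      ‖((PreTilt.untilt (pFlat : PreTilt (integerC F) p) : integerC F) : CompletedAlgClosure F)‖ := by
  rw [map_pow, untilt_unifFlat, untilt_pFlat, SubmonoidClass.coe_pow, norm_pow, D.norm_unifC_pow, coe_natCast_integerC]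

/-- **`(ϖ♭)^e = p♭ · u` for a unit `u` of `𝒪_{ℂ_F}♭`** (`‖(ϖ^e)‖ = ‖p‖`, and `𝒪_{ℂ_F}♭` is a valuation ring
for `‖·♯‖`). [cite: FarguesFontaine2018, §2.2] [cite: FontaineOuyang2022, Prop. 4.3.3] -/
theorem exists_unifFlat_pow_eq_pFlat_mul :
    ∃ u : (PreTilt (integerC F) p)ˣ, D.unifFlat ^ D.deg = (pFlat : PreTilt (integerC F) p) * (u : PreTilt (integerC F) p) := by
  have hp0 : ((PreTilt.untilt (pFlat : PreTilt (integerC F) p) : integerC F) : CompletedAlgClosure F) ≠ 0 := by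
    rw [untilt_pFlat, coe_natCast_integerC]; exact natCast_C_ne_zero (F := F) (Fact.out : p.Prime).ne_zero
  exact PreTilt.exists_unit_eq_mul_of_norm_untilt_eq hp0 D.norm_untilt_unifFlat_pow

end EisensteinRootW

/-! ## §3 `ω = ϖ − [ϖ♭]` and `f([ϖ♭]) = ξ · unit` -/

namespace AinfRamW

variable [CharZero F] [Fact (¬ IsUnit (p : integerC F))] {hp : valuation F p < 1} (D : EisensteinRootW F p hp)

/-- **The degree-one primitive element `ω = ϖ − [ϖ♭] ∈ A_inf(𝒪)`** (Fargues–Fontaine), the generator of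
`ker θ_𝒪` — the analogue of `ξ = [p♭] − p` for the uniformizer `ϖ` in place of `p`.
[cite: FarguesFontaine2018, §2.2 (Déf. 2.2.1)] -/
def omega : AinfRamW D := varpi D - algebraMap (Ainf (p := p) F) (AinfRamW D) (teichmuller p D.unifFlat)

/-- Unfolding `ω`. [cite: FarguesFontaine2018, §2.2] -/
theorem omega_def : omega D = varpi D - algebraMap (Ainf (p := p) F) (AinfRamW D) (teichmuller p D.unifFlat) := rfl
/-- `ω` is the class of the polynomial `X − [ϖ♭]`. [cite: FarguesFontaine2018, §2.2] -/
theorem mk_X_sub_C : AdjoinRoot.mk D.polyAinf (X - C (teichmuller p D.unifFlat)) = omega D := by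
  rw [map_sub, AdjoinRoot.mk_X, AdjoinRoot.mk_C, omega_def, varpi, algebraMap_eq]

/-- Eisenstein divisibility transported to `𝔸_inf(F)`: for `i < deg`, `c₀(a_i) = p · c₀(d)` for some `d ∈ W_F`
(stated with the product already in `𝔸_inf(F)`, so that no cast has to be moved across `c₀` downstream).
[cite: SerreLocalFields1979, Ch. I §6 Prop. 17] -/
theorem _root_.Literature.NumberTheory.PAdicHodge.EisensteinRootW.exists_wittFixedToAinf_coeff_eq {i : ℕ}
    (hi : i < D.deg) : ∃ d : wittFixed F p,
      wittFixedToAinf F p hp (D.poly.coeff i) = (p : Ainf (p := p) F) * wittFixedToAinf F p hp d := by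
  obtain ⟨d, hd⟩ := D.dvd_coeff hi
  exact ⟨d, by rw [hd, map_mul, map_natCast]⟩

/-- **`f([ϖ♭]) = [ϖ♭]^e + p·b` in `𝔸_inf(F)`**: modulo `p` the Eisenstein polynomial is `X^e`.
[cite: SerreLocalFields1979, Ch. I §6 Prop. 17] -/
theorem exists_eval_teichmuller_unifFlat_eq :
    ∃ b : Ainf (p := p) F, D.polyAinf.eval (teichmuller p D.unifFlat) = teichmuller p D.unifFlat ^ D.deg + (p : Ainf (p := p) F) * b := by
  set x := teichmuller p D.unifFlat with hx
  choose d hd using fun i : Finset.range D.deg => D.exists_wittFixedToAinf_coeff_eq (hp := hp) (Finset.mem_range.1 i.2)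
  refine ⟨∑ i : Finset.range D.deg, wittFixedToAinf F p hp (d i) * x ^ (i : ℕ), ?_⟩
  rw [Polynomial.eval_eq_sum_range, D.natDegree_polyAinf, Finset.sum_range_succ]
  have hlead : D.polyAinf.coeff D.deg = 1 := by
    have h : D.polyAinf.Monic := D.monic_polyAinf
    rw [Polynomial.Monic, Polynomial.leadingCoeff, D.natDegree_polyAinf] at h
    exact h
  rw [hlead, one_mul, add_comm, add_right_inj, Finset.mul_sum, ← Finset.sum_coe_sort]
  refine Finset.sum_congr rfl fun i _ => ?_
  -- (the cast `↑p` is moved across `c₀` in `exists_wittFixedToAinf_coeff_eq`, not here: doing it inside this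
  -- goal makes the unifier compare two instance paths on `W_F` and exhausts the heartbeats)
  rw [EisensteinRootW.polyAinf_def, Polynomial.coeff_map, hd i, mul_assoc]

/-- Every element of `A_inf(𝒪)` is congruent modulo `ω` to an element of `𝔸_inf(F)`: the class of `q` is
`q([ϖ♭]) + ω · (class of the quotient of `q` by `X − [ϖ♭]`)`. [cite: FarguesFontaine2018, §2.2] -/
theorem mk_eq_algebraMap_eval_add (q : (Ainf (p := p) F)[X]) :
    AdjoinRoot.mk D.polyAinf q = algebraMap (Ainf (p := p) F) (AinfRamW D) (q.eval (teichmuller p D.unifFlat)) +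
      omega D * AdjoinRoot.mk D.polyAinf (q /ₘ (X - C (teichmuller p D.unifFlat))) := by
  set a := teichmuller p D.unifFlat with ha
  have hq : q = C (q.eval a) + (X - C a) * (q /ₘ (X - C a)) := by
    conv_lhs => rw [← Polynomial.modByMonic_add_div q (X - C a), Polynomial.modByMonic_X_sub_C_eq_C_eval]
  conv_lhs => rw [hq]
  rw [map_add, map_mul, AdjoinRoot.mk_C, mk_X_sub_C, algebraMap_eq]

variable [IsAdicComplete (Ideal.span {(p : integerC F)}) (integerC F)]

/-- **`θ_𝒪(ω) = ϖ − ϖ = 0`.** [cite: FarguesFontaine2018, §2.2] -/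
theorem theta_omega : theta D (omega D) = 0 := by
  rw [omega_def, map_sub, theta_varpi, theta_algebraMap, D.fontaineTheta_teichmuller_unifFlat, sub_self]

/-- `ω ∈ ker θ_𝒪`. [cite: FarguesFontaine2018, §2.2] -/
theorem omega_mem_ker : omega D ∈ RingHom.ker (theta D) := theta_omega D
/-- **`θ(f([ϖ♭])) = f(θ[ϖ♭]) = f(ϖ) = 0`.** [cite: FarguesFontaine2018, §2.2] -/
theorem fontaineTheta_eval_teichmuller_unifFlat :
    fontaineTheta (integerC F) p (D.polyAinf.eval (teichmuller p D.unifFlat)) = 0 := by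
  rw [Polynomial.eval, Polynomial.hom_eval₂, RingHom.comp_id, D.fontaineTheta_teichmuller_unifFlat,
    EisensteinRootW.eval₂_polyAinf, fontaineTheta_comp_wittFixedToAinf hp]
  exact D.eval₂_wittFixedToIntC_unifC

/-- **`f([ϖ♭]) = ξ · u` with `u` a unit of `𝔸_inf(F)`** — Fontaine's criterion for generators of `ker θ`:
`f([ϖ♭]) ∈ ker θ = ξ𝔸_inf`, and modulo `p` it is `(ϖ♭)^e = p♭ · unit = (ξ mod p) · unit`.
[cite: FontaineAsterisque223III, Exp. II §1.2.2] [cite: FarguesFontaine2018, §2.2] -/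
theorem exists_unit_eval_teichmuller_unifFlat_eq :
    ∃ u : (Ainf (p := p) F)ˣ, D.polyAinf.eval (teichmuller p D.unifFlat) = xi * (u : Ainf (p := p) F) := by
  obtain ⟨a, ha⟩ := xi_dvd_of_fontaineTheta_eq_zero (fontaineTheta_eval_teichmuller_unifFlat D)
  obtain ⟨b, hb⟩ := exists_eval_teichmuller_unifFlat_eq D
  obtain ⟨u₀, hu₀⟩ := D.exists_unifFlat_pow_eq_pFlat_mul
  have h1 : (pFlat : PreTilt (integerC F) p) * WittVector.constantCoeff a = pFlat * (u₀ : PreTilt (integerC F) p) := by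
    have ha' := congrArg WittVector.constantCoeff ha
    have hb' := congrArg WittVector.constantCoeff hb
    rw [map_mul, constantCoeff_xi] at ha'
    rw [map_add, map_mul, map_pow, map_natCast, CharP.cast_eq_zero, zero_mul, add_zero,
      WittVector.constantCoeff_apply (teichmuller p D.unifFlat), teichmuller_coeff_zero, hu₀] at hb'
    rw [← ha', ← hb']
  have h2 : WittVector.constantCoeff a = u₀ := mul_left_cancel₀ pFlat_ne_zero h1
  have h3 : IsUnit a := Ainf.isUnit_of_isUnit_constantCoeff (by rw [h2]; exact u₀.isUnit)
  exact ⟨h3.unit, by rw [IsUnit.unit_spec]; exact ha⟩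

/-! ## §4 `ker θ_𝒪 = ω · A_inf(𝒪)` -/

/-- **`ξ ∈ ω · A_inf(𝒪)`**: `ξ · u = f([ϖ♭]) = f([ϖ♭]) − f(ϖ)` is divisible by `[ϖ♭] − ϖ = −ω`.
[cite: FarguesFontaine2018, §2.2] -/
theorem xi_mem_span_omega : algebraMap (Ainf (p := p) F) (AinfRamW D) xi ∈ Ideal.span {omega D} := by
  obtain ⟨u, hu⟩ := exists_unit_eval_teichmuller_unifFlat_eq D
  set g : (AinfRamW D)[X] := D.polyAinf.map (algebraMap (Ainf (p := p) F) (AinfRamW D)) with hg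
  have h1 : g.eval (varpi D) = 0 := by rw [hg, Polynomial.eval_map]; exact eval₂_varpi D
  have h2 : g.eval (algebraMap (Ainf (p := p) F) (AinfRamW D) (teichmuller p D.unifFlat)) =
      algebraMap (Ainf (p := p) F) (AinfRamW D) xi * algebraMap (Ainf (p := p) F) (AinfRamW D) (u : Ainf (p := p) F) := by
    rw [hg, Polynomial.eval_map, Polynomial.eval₂_hom, hu, map_mul]
  have h3 := Polynomial.sub_dvd_eval_sub (varpi D) (algebraMap (Ainf (p := p) F) (AinfRamW D) (teichmuller p D.unifFlat)) g
  rw [h1, h2, zero_sub, ← omega_def, dvd_neg] at h3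
  rw [Ideal.mem_span_singleton]
  exact (IsUnit.dvd_mul_right (u.isUnit.map _)).1 h3

/-- **`ker θ_𝒪 = ω · A_inf(𝒪)`** (Fargues–Fontaine: a primitive element of degree one generates the kernel of
`θ`). If `θ_𝒪(x) = 0`, write `x = r + ω t` with `r ∈ 𝔸_inf(F)`; then `θ(r) = 0`, so `r ∈ ξ𝔸_inf ⊆ ω A_inf(𝒪)`.
[cite: FarguesFontaine2018, §2.2 (Cor. 2.2.8)] [cite: FontaineAsterisque223III, Exp. II §1.2.2] -/
theorem ker_theta_eq_span_omega : RingHom.ker (theta D) = Ideal.span {omega D} := by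
  refine le_antisymm (fun x hx => ?_) ((Ideal.span_singleton_le_iff_mem _).2 (omega_mem_ker D))
  rw [RingHom.mem_ker] at hx
  obtain ⟨q, rfl⟩ := AdjoinRoot.mk_surjective x
  have hθ : fontaineTheta (integerC F) p (q.eval (teichmuller p D.unifFlat)) = 0 := by
    rw [mk_eq_algebraMap_eval_add, map_add, map_mul, theta_omega, zero_mul, add_zero, theta_algebraMap] at hx
    exact hx
  obtain ⟨s, hs⟩ := xi_dvd_of_fontaineTheta_eq_zero hθ
  rw [mk_eq_algebraMap_eval_add, hs, map_mul]
  exact Ideal.add_mem _ (Ideal.mul_mem_right _ _ (xi_mem_span_omega D))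
    (Ideal.mul_mem_right _ _ (Ideal.mem_span_singleton_self _))

/-- `θ_𝒪(x) = 0 ⟹ ω ∣ x`. [cite: FarguesFontaine2018, §2.2 (Cor. 2.2.8)] -/
theorem omega_dvd_of_theta_eq_zero {x : AinfRamW D} (hx : theta D x = 0) : omega D ∣ x := by
  rw [← Ideal.mem_span_singleton, ← ker_theta_eq_span_omega]; exact hx

/-- **`θ_𝒪(x) = 0 ↔ ω ∣ x`.** [cite: FarguesFontaine2018, §2.2 (Cor. 2.2.8)] -/
theorem theta_eq_zero_iff_omega_dvd (x : AinfRamW D) : theta D x = 0 ↔ omega D ∣ x := by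
  refine ⟨omega_dvd_of_theta_eq_zero D, fun ⟨c, hc⟩ => ?_⟩
  rw [hc, map_mul, theta_omega, zero_mul]

/-- `ξ = ω · c` in `A_inf(𝒪)` for some `c`. [cite: FarguesFontaine2018, §2.2] -/
theorem omega_dvd_xi : omega D ∣ algebraMap (Ainf (p := p) F) (AinfRamW D) xi :=
  Ideal.mem_span_singleton.1 (xi_mem_span_omega D)

/-- **`Γ_F` preserves `ω · A_inf(𝒪)`**: `σ(ω) = ϖ − [σ♭ ϖ♭] ∈ ker θ_𝒪 = ω A_inf(𝒪)`. [cite: FontaineAsterisque223III, Exp. II §1.2] -/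
theorem omega_dvd_gal_omega (σ : absoluteGaloisGroup F) : omega D ∣ gal D σ (omega D) :=
  omega_dvd_of_theta_eq_zero D (theta_gal_eq_zero D σ (theta_omega D))

/-- `σ` maps `ω · A_inf(𝒪)` into itself. [cite: FontaineAsterisque223III, Exp. II §1.2] -/
theorem span_omega_map_gal_le (σ : absoluteGaloisGroup F) :
    (Ideal.span {omega D}).map (gal D σ) ≤ Ideal.span {omega D} := by
  rw [Ideal.map_span, Set.image_singleton, Ideal.span_singleton_le_iff_mem, Ideal.mem_span_singleton]
  exact omega_dvd_gal_omega D σ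

end AinfRamW

end Literature.NumberTheory.PAdicHodge

end
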